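import Mathlib.ModelTheory.Definability
import Literature.ModelTheory.ExponentialFields.OMinimalDefinability
import HarnessLib

/-!
# Definable families of functions (uniform definability in parameters)

Topic `Literature/ModelTheory/ExponentialFields`.  Arguments "uniform in parameters" in
o-minimality — uniform finiteness (van den Dries 1998, Ch. 3, (2.13)), definable dependence of
reparametrizations on parameters (Pila–Wilkie 2006, §§3–5: *"the functions comprising `S_y`
depend definably on `y`"*, Cor. 5.2) — quantify over **definable families** of functions: a
function `Φ v` of `x` for each parameter tuple `v`, such that `(v, x) ↦ Φ v x` is definable.  In
Mathlib's semantic setting (`Set.DefinableFun`: the graph of a function of tuples is a definable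
set) the convenient form of this condition is a closure property: substituting definable
tuple-functions for the parameters and for the argument yields a definable function of tuples.
This file records that notion, for unary functions (`IsDefinableFamily₁`) and for functions of
tuples (`IsDefinableFamily`), with its basic API; for finitely many parameters it is equivalent
to the definability of the single function `(v, x) ↦ Φ v x` of `n + 1` variables
(`isDefinableFamily₁_iff_definableFun_snoc`).  Folklore bookkeeping (van den Dries 1998, Ch. 1,
(2.3): definable maps are closed under composition); no named facts.

## References

* [Dries1998] L. van den Dries, *Tame topology and o-minimal structures*, CUP 1998, Ch. 1,
  (2.3); Ch. 3, (2.13).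
* [PilaWilkie2006] J. Pila, A. J. Wilkie, *The rational points of a definable set*, Duke Math.
  J. 133 (2006), Cor. 5.2.
-/

open Set FirstOrder FirstOrder.Language

namespace Literature.ModelTheory.ExponentialFields

universe u v

variable {L : Language.{u, v}} {M : Type} [L.Structure M] {β : Type}

variable (L) in
/-- A family `Φ v : M → M` of unary functions indexed by parameter tuples `v : β → M` is a
**definable family** if for every finite variable type `γ` and all definable tuple-functions
`q : M^γ → M^β` (parameters) and `t : M^γ → M` (argument), the function `u ↦ Φ (q u) (t u)` of
`γ`-tuples is definable (with parameters from all of `M`).  For finite `β` this says exactly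
that `(v, x) ↦ Φ v x` is a definable function of `β ⊕ 1` variables
(`isDefinableFamily₁_iff_definableFun_snoc`); the closure form is the one consumed by
first-order constructions (van den Dries 1998, Ch. 1, (2.3)(iii)). A definition (predicate with
explicit binders), not a claim. [cite: Dries1998, Ch. 1 (2.3)] -/
def IsDefinableFamily₁ (Φ : (β → M) → M → M) : Prop :=
  ∀ (γ : Type) [Finite γ] (q : (γ → M) → β → M) (t : (γ → M) → M),
    (univ : Set M).DefinableMap L q → (univ : Set M).DefinableFun L t →
      (univ : Set M).DefinableFun L (fun u => Φ (q u) (t u))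

variable (L) in
/-- A family `Ψ v : M^δ → M` of functions of tuples indexed by parameter tuples `v : β → M` is
a **definable family** if substituting definable tuple-maps for the parameters and the
arguments yields a definable function of tuples (van den Dries 1998, Ch. 1, (2.3)(iii)).
A definition (predicate with explicit binders), not a claim. [cite: Dries1998, Ch. 1 (2.3)] -/
def IsDefinableFamily {δ : Type} (Ψ : (β → M) → (δ → M) → M) : Prop :=
  ∀ (γ : Type) [Finite γ] (q : (γ → M) → β → M) (T : (γ → M) → δ → M),
    (univ : Set M).DefinableMap L q → (univ : Set M).DefinableMap L T →
      (univ : Set M).DefinableFun L (fun u => Ψ (q u) (T u))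

/-- Unfolding lemma for `IsDefinableFamily₁`. [folklore] -/
theorem isDefinableFamily₁_iff {Φ : (β → M) → M → M} :
    IsDefinableFamily₁ L Φ ↔
      ∀ (γ : Type) [Finite γ] (q : (γ → M) → β → M) (t : (γ → M) → M),
        (univ : Set M).DefinableMap L q → (univ : Set M).DefinableFun L t →
          (univ : Set M).DefinableFun L (fun u => Φ (q u) (t u)) :=
  Iff.rfl

/-- Unfolding lemma for `IsDefinableFamily`. [folklore] -/
theorem isDefinableFamily_iff {δ : Type} {Ψ : (β → M) → (δ → M) → M} :
    IsDefinableFamily L Ψ ↔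
      ∀ (γ : Type) [Finite γ] (q : (γ → M) → β → M) (T : (γ → M) → δ → M),
        (univ : Set M).DefinableMap L q → (univ : Set M).DefinableMap L T →
          (univ : Set M).DefinableFun L (fun u => Ψ (q u) (T u)) :=
  Iff.rfl

namespace IsDefinableFamily₁

variable {Φ : (β → M) → M → M}

/-- Members of a definable family, evaluated along definable data, are definable functions.
[folklore] -/
theorem definableFun (hΦ : IsDefinableFamily₁ L Φ) {γ : Type} [Finite γ]
    {q : (γ → M) → β → M} {t : (γ → M) → M} (hq : (univ : Set M).DefinableMap L q)
    (ht : (univ : Set M).DefinableFun L t) :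
    (univ : Set M).DefinableFun L (fun u => Φ (q u) (t u)) :=
  hΦ γ q t hq ht

/-- Each member `Φ v` of a definable family, as a function of `1`-tuples, is definable.
[folklore] -/
theorem definableFun_apply (hΦ : IsDefinableFamily₁ L Φ) (v : β → M) :
    (univ : Set M).DefinableFun L (fun u : Fin 1 → M => Φ v (u 0)) :=
  hΦ (Fin 1) (fun _ => v) (fun u => u 0) (fun i => definableFun_const' _ (v i))
    (definableFun_proj 0)

/-- The graph `{(x, y) | y = Φ v x}` of each member of a definable family is definable (the
form consumed by the monotonicity theorem, `OMinimalMonotonicity.lean`). [folklore] -/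
theorem definable_graph (hΦ : IsDefinableFamily₁ L Φ) (v : β → M) :
    (univ : Set M).Definable L {w : Fin 2 → M | w 1 = Φ v (w 0)} := by
  have h := hΦ.definableFun_apply v
  unfold Set.DefinableFun at h
  have h2 := h.preimage_comp (fun o : Option (Fin 1) => (o.elim 1 fun _ => 0 : Fin 2))
  convert h2 using 1
  ext w
  simp only [mem_setOf_eq, mem_preimage, Function.tupleGraph, Function.comp_def]
  constructor
  · intro hw
    simpa using hw.symm
  · intro hw
    simpa using hw.symm

/-- A family that is constant in the parameters, given by one function with definable graph,
is a definable family. [folklore] -/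
theorem of_graph {f : M → M} (hf : (univ : Set M).Definable L {v : Fin 2 → M | v 1 = f (v 0)}) :
    IsDefinableFamily₁ L (fun (_ : β → M) (x : M) => f x) :=
  fun _ _ _ _ _ ht => Literature.ModelTheory.ExponentialFields.definableFun_apply hf ht

/-- Re-indexing the parameters along a map of index types preserves definable families.
[folklore] -/
theorem comp_index (hΦ : IsDefinableFamily₁ L Φ) {β' : Type} (σ : β → β') :
    IsDefinableFamily₁ L (fun (v : β' → M) (x : M) => Φ (v ∘ σ) x) :=
  fun γ _ q t hq ht => hΦ γ (fun u => q u ∘ σ) t (fun i => hq (σ i)) ht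

/-- Substituting a definable map of the parameters preserves definable families. [folklore] -/
theorem comp_definableMap (hΦ : IsDefinableFamily₁ L Φ) {β' : Type} [Finite β']
    {p : (β' → M) → β → M} (hp : (univ : Set M).DefinableMap L p) :
    IsDefinableFamily₁ L (fun (v : β' → M) (x : M) => Φ (p v) x) :=
  fun γ _ q t hq ht => hΦ γ (fun u => p (q u)) t (fun i => (hp i).comp hq) ht

end IsDefinableFamily₁

/-- **For finitely many parameters, a definable family is one definable function of `n + 1`
variables**: `Φ` is a definable family iff `w ↦ Φ (w₀, …, w_{n-1}) (w_n)` is a definable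
function of `(n+1)`-tuples. [cite: Dries1998, Ch. 1 (2.3)] -/
theorem isDefinableFamily₁_iff_definableFun_snoc {n : ℕ} {Φ : (Fin n → M) → M → M} :
    IsDefinableFamily₁ L Φ ↔
      (univ : Set M).DefinableFun L (fun w : Fin (n + 1) → M => Φ (Fin.init w) (w (Fin.last n))) := by
  constructor
  · intro hΦ
    exact hΦ (Fin (n + 1)) Fin.init (fun w => w (Fin.last n))
      (fun i => definableFun_proj (Fin.castSucc i)) (definableFun_proj (Fin.last n))
  · intro hF γ _ q t hq ht
    have hsnoc : (univ : Set M).DefinableMap L (fun u : γ → M => (Fin.snoc (q u) (t u) : Fin (n + 1) → M)) := by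
      intro i
      refine Fin.lastCases ?_ (fun j => ?_) i
      · simp only [Fin.snoc_last]
        exact ht
      · simp only [Fin.snoc_castSucc]
        exact hq j
    have h := hF.comp hsnoc
    simpa only [Fin.init_snoc, Fin.snoc_last] using h

namespace IsDefinableFamily

variable {δ : Type} {Ψ : (β → M) → (δ → M) → M}

/-- Members of a definable family of functions of tuples, evaluated along definable data, are
definable functions. [folklore] -/
theorem definableFun (hΨ : IsDefinableFamily L Ψ) {γ : Type} [Finite γ]
    {q : (γ → M) → β → M} {T : (γ → M) → δ → M} (hq : (univ : Set M).DefinableMap L q)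
    (hT : (univ : Set M).DefinableMap L T) :
    (univ : Set M).DefinableFun L (fun u => Ψ (q u) (T u)) :=
  hΨ γ q T hq hT

/-- **Slices are definable families of unary functions**: fixing all coordinates but `i` of the
argument (and recording them as extra parameters) turns a definable family of functions of
`δ`-tuples into a definable family of unary functions with parameters `β ⊕ δ` (the value of
the frozen tuple at `i` is ignored). [folklore] -/
theorem slice [DecidableEq δ] (hΨ : IsDefinableFamily L Ψ) (i : δ) :
    IsDefinableFamily₁ L (fun (vz : β ⊕ δ → M) (x : M) =>
      Ψ (vz ∘ Sum.inl) (Function.update (vz ∘ Sum.inr) i x)) := by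
  intro γ _ q t hq ht
  refine hΨ γ (fun u => q u ∘ Sum.inl) (fun u => Function.update (q u ∘ Sum.inr) i (t u))
    (fun b => hq (Sum.inl b)) fun j => ?_
  by_cases hj : j = i
  · subst hj
    simp only [Function.update_self]
    exact ht
  · simp only [Function.update_of_ne hj, Function.comp_apply]
    exact hq (Sum.inr j)

/-- A definable family of unary functions is a definable family of functions of `1`-tuples.
[folklore] -/
theorem of_isDefinableFamily₁ {Φ : (β → M) → M → M} (hΦ : IsDefinableFamily₁ L Φ) :
    IsDefinableFamily L (fun (v : β → M) (z : Fin 1 → M) => Φ v (z 0)) :=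
  fun γ _ q T hq hT => hΦ γ q (fun u => T u 0) hq (hT 0)

end IsDefinableFamily

end Literature.ModelTheory.ExponentialFields
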